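import Summits.CriticalPhenomena.PercolationContinuityZ3.Theorems.PercNearOneGluingNoHeavyLowerTailThreePartitionTwistedPrincipal

/-!
# `NoHeavyLowerTail` (crux stmt-CriticalPhenomena-4575): CONE CLOSURE of the twisted three-partition positivity class

Support file (lane `prim-ineq-gen-4`, generation 15; `--supports stmt-CriticalPhenomena-4575`).  Pure proofs, no definitions, no `sorry`, standard axioms.
Say an up-set family `𝒰 ⊆ 𝒫(ι)` is TPP-GOOD if `0 ≤ threePartNT τ 𝒰 𝒱 𝒲` for every twist `τ` and all up-sets `𝒱, 𝒲` (`ThreePartitionPositivityTwisted` asserts that every up-set is).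
THEOREM (`threePartNT_cone_nonneg`): if `ℬ` is `e`-free (`T ∈ ℬ ↔ insert e T ∈ ℬ`) and TPP-good, then its CONE `{T | e ∈ T ∧ T ∈ ℬ}` ("additionally require coordinate `e`") is TPP-good —
the two cone steps of `…ThreePartitionTwistedCone` / `…ThreePartitionTwistedConeTwo` with `𝒰ᵉ = ℬ`.  (Principal filters = iterated cones of `univ`, recovering `threePartNT_principal_nonneg`.)
HONEST LABEL: a closure property of the conjecture's good class, not the conjecture. [this work]
-/

noncomputable section

open Finset
open scoped symmDiff Classical

namespace Summit.CriticalPhenomena.PercolationContinuityZ3.Theorems.ThreePartition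

variable {ι : Type*} [Fintype ι]

/-- **Cone closure.**  If `ℬ` is an `e`-free up-set family that is nonnegative for the twisted three-partition functional against all up-sets and all
twists, then so is its cone `{T | e ∈ T ∧ T ∈ ℬ}`. [this work] -/
theorem threePartNT_cone_nonneg (e : ι) {ℬ : Set (Set ι)} (hℬ : IsUpperSet ℬ) (hfree : ∀ T, T ∈ ℬ ↔ insert e T ∈ ℬ)
    (hgood : ∀ (τ : Set ι) {𝒱 𝒲 : Set (Set ι)}, IsUpperSet 𝒱 → IsUpperSet 𝒲 → 0 ≤ threePartNT τ ℬ 𝒱 𝒲)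
    (τ : Set ι) {𝒱 𝒲 : Set (Set ι)} (h𝒱 : IsUpperSet 𝒱) (h𝒲 : IsUpperSet 𝒲) :
    0 ≤ threePartNT τ {T : Set ι | e ∈ T ∧ T ∈ ℬ} 𝒱 𝒲 := by
  have hU : IsUpperSet {T : Set ι | e ∈ T ∧ T ∈ ℬ} := fun A B hAB hA => ⟨hAB hA.1, hℬ hAB hA.2⟩
  have hUe : ∀ T ∈ {T : Set ι | e ∈ T ∧ T ∈ ℬ}, e ∈ T := fun T hT => hT.1
  have hlift : {R : Set ι | insert e R ∈ {T : Set ι | e ∈ T ∧ T ∈ ℬ}} = ℬ := by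
    ext R
    simp only [Set.mem_setOf_eq, Set.mem_insert_iff, true_or, true_and]
    exact (hfree R).symm
  by_cases heτ : e ∈ τ
  · have hne : e ∉ τ \ {e} := fun h => h.2 rfl
    have h3 := two_mul_threePartNT_lift_le_three_mul (τ \ {e}) e hne hU h𝒱 h𝒲 hUe
    rw [hlift, insert_sdiff_singleton_of_mem heτ] at h3
    have h0 := hgood (τ \ {e}) (isUpperSet_liftAt e h𝒱) (isUpperSet_liftAt e h𝒲)
    linarith
  · have h3 := threePartNT_lift_le_three_mul τ e heτ hU h𝒱 h𝒲 hUe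
    rw [hlift] at h3
    have h0 := hgood τ (isUpperSet_liftAt e h𝒱) (isUpperSet_liftAt e h𝒲)
    linarith

end Summit.CriticalPhenomena.PercolationContinuityZ3.Theorems.ThreePartition
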